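import Literature.NumberTheory.NumberFields.KurodaRelationSymmetricThreeExact
import Literature.NumberTheory.IwasawaTheory.SymmetricThreeTowerLambda
import HarnessLib

set_option autoImplicit false

/-!
# The EXACT `S₃` relation up a `ℤ₂`-tower: `e_n(L) + 2e_n(L^{⟨σ,τ⟩}) = e_n(L^{⟨σ⟩}) + 2e_n(L^{⟨τ⟩})` at every layer,
# hence the Iwasawa invariants of an `S₃`-extension are the resolvent's plus twice the cubic's

Topic `NumberTheory/IwasawaTheory` (namespace = path).  THEOREM-ONLY file (no definition, no named fact, no `sorry`), written by
the prover seat `bsd-line-att-p4` g30 (cell `bsd-f1-sign2`, route `AlignedTransportAtTwo`, `--supports` stmt-BirchSwinnertonDyer-22298,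
whose sextic carrier `ℚ(W[2])` is an `S₃`-extension of `ℚ` with cubic subfield `ℚ(β)` and quadratic resolvent `ℚ(√Δ_W)`; closes nothing;
BSD is proved for no curve here).  Sequel of `NumberFields/KurodaRelationSymmetricThreeExact.lean` (the exact `2`-part of the `S₃` class
number relation, Walter / Caputo–Nuccio Prop. 3.12) and of att-p3 g33's `SymmetricThreeTowerLambda.lean` (whose sandwich and `λ` identity
needed `μ = 0` on three towers and an odd-class-number base; both hypotheses are now removed).

SETTING (Washington §13.1, the tree's restricted towers; notation of `SymmetricThreeTowerLambda.lean`).  `F` a number field, `κ` a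
`ℤ₂`-extension of `F`, `L/F` finite Galois with `κ ∘ res` onto, `σ, τ ∈ Gal(L/F)` with `σ³ = 1`, `τ² = 1`, `τσ = σ²τ`; `R = L^{⟨σ⟩}`,
`K = L^{⟨τ⟩}`, `k = L^{⟨σ,τ⟩}`; `e_n(X) = classNumberPExp (κ|_X) n`.

* §1 **`classNumberPExp_symmetricThree_exact`** — **`e_n(L) + 2·e_n(k) = e_n(R) + 2·e_n(K)` for EVERY `n`** (no hypothesis): at layer `n`
  the section `s : Gal(L/F) ↪ Gal(L·F_n/F)` carries `σ, τ` to an `S₃`-pair whose fixed fields are the layers (`RestrictedTowerLayerSection`),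
  and `padicValNat_two_classNumber_symmetricThree` applies to `L·F_n`.
* §2 **`classicalMuVanishes_symmetricThree_of_three`** — growth form (`μ = 0`) for the towers over `R`, `K`, `k` gives it for `L`, with
  **`classicalLambda_symmetricThree_exact`**: `λ(L) + 2λ(k) = λ(R) + 2λ(K)` (and `classicalMuVanishes_resolvent_of_three`: `L, K, k ⟹ R`).
  att-p3's `classicalLambda_symmetricThree` is the case `e_n(k) = 0`, with its hypothesis `hμL` now a CONSEQUENCE.
* §3 (att-p4 g31) **the square closed**: `classicalMuVanishes_fixedField_tau_of_three` (`L, R, k ⟹ K`, by HALVING the growth law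
  `2e_n(K) = e_n(L) + 2e_n(k) − e_n(R)`: slope and constant are even, slope `≥ 0`) and `classicalMuVanishes_fixedField_closure_of_three`
  (`L, R, K ⟹ k`), each with the exact `λ`; `classicalMuVanishes_iff_fixedField_tau_of_resolvent_of_base`: given `μ(R) = μ(k) = 0`,
  **`μ(L) = 0 ⟺ μ(K) = 0`**.

References: [CaputoNuccio2020] Prop. 3.12, Rem. 3.13; [Bartel2012] Cor. 5.2; [Washington1997] §13.1, §13.3 (Thm. 13.13);
[Lang1990] Ch. 5 §1, Ch. 13 §4.
-/

noncomputable section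

open scoped NumberField Classical
open NumberField Field IntermediateField

namespace Literature.NumberTheory.IwasawaTheory

open Literature.NumberTheory.EllipticCurves Literature.NumberTheory.EllipticCurves.ZpExtension
  Literature.NumberTheory.GaloisRepresentations Literature.NumberTheory.NumberFields
  Literature.NumberTheory.NumberFields.KurodaSymmetricThree

variable {F : Type} [Field F] [NumberField F]

/-! ### §1 The exact relation at every layer -/

/-- **The EXACT `S₃` relation at layer `n`.**  `κ` a `ℤ₂`-extension of `F`, `L/F` Galois with `κ ∘ res` onto, `σ³ = 1`, `τ² = 1`,
`τσ = σ²τ` in `Gal(L/F)`, `R = L^{⟨σ⟩}`, `K = L^{⟨τ⟩}`, `k = L^{⟨σ,τ⟩}`.  Then for every `n`: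
**`e_n(L) + 2·e_n(k) = e_n(R) + 2·e_n(K)`** — the `2`-part of the Brauer–Kuroda relation at every layer of the tower, with NO `μ = 0`,
`2`-freeness or odd-class-number hypothesis (Walter's hypotheses verbatim: any base, any `S₃ = D₃` Galois extension, no class-number
proviso — applied to the `S₃`-extensions `L·F_n / k·F_n`).  This EXACT per-layer identity is sharper than the printed tower forms of
Brauer–Kuroda relations, which hold up to a bounded error term (informally it gives `μ(L) + 2μ(k) = μ(R) + 2μ(K)` and
`λ(L) + 2λ(k) = λ(R) + 2λ(K)`; in the kernel's growth-form vocabulary: §2). [cite: CaputoNuccio2020, Prop. 3.12] [cite: Bartel2012, Cor. 5.2] [cite: Washington1997, §13.1] -/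
theorem classNumberPExp_symmetricThree_exact (κ : ZpExtension F 2) (L : Type) [Field L] [NumberField L] [Algebra F L]
    [IsGalois F L] (hL : Function.Surjective (κ.toContinuousMonoidHom.comp (absGaloisRestrict F L)))
    {σ τ : L ≃ₐ[F] L} (hσ : σ ^ 3 = 1) (hτ : τ ^ 2 = 1) (hτσ : τ * σ = σ ^ 2 * τ)
    (hR : Function.Surjective (κ.toContinuousMonoidHom.comp (absGaloisRestrict F ↥(fixedField (Subgroup.zpowers σ)))))
    (hK : Function.Surjective (κ.toContinuousMonoidHom.comp (absGaloisRestrict F ↥(fixedField (Subgroup.zpowers τ)))))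
    (hk : Function.Surjective (κ.toContinuousMonoidHom.comp
      (absGaloisRestrict F ↥(fixedField (Subgroup.closure ({σ, τ} : Set (L ≃ₐ[F] L)))))))
    (n : ℕ) :
    classNumberPExp (κ.restrict L hL) n +
        2 * classNumberPExp (κ.restrict ↥(fixedField (Subgroup.closure ({σ, τ} : Set (L ≃ₐ[F] L)))) hk) n =
      classNumberPExp (κ.restrict ↥(fixedField (Subgroup.zpowers σ)) hR) n +
        2 * classNumberPExp (κ.restrict ↥(fixedField (Subgroup.zpowers τ)) hK) n := by
  classical
  haveI : FiniteDimensional F L := Module.Finite.of_restrictScalars_finite ℚ F L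
  set e : L →ₐ[F] AlgebraicClosure F := absEmbedding F L with he
  haveI := isGalois_fieldRange_sup_layer κ L e n
  haveI := finiteDimensional_fieldRange_sup_layer κ L e n
  haveI := numberField_fieldRange_sup_layer κ L e n
  obtain ⟨s, hs_inj, -, hcard⟩ := exists_section_fixedField_map_eq κ L hL n
  haveI : NumberField ↥((κ.restrict L hL).layer n) := by
    haveI : FiniteDimensional L ↥((κ.restrict L hL).layer n) := (κ.restrict L hL).finiteDimensional_layer_holds n
    exact NumberField.of_module_finite L _
  obtain ⟨eL⟩ := nonempty_ringEquiv_layer_restrict_fieldRange_sup_layer κ L hL e n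
  -- the `S₃`-pair at layer `n`
  have hσ' : s σ ^ 3 = 1 := by rw [← map_pow, hσ, map_one]
  have hτ' : s τ ^ 2 = 1 := by rw [← map_pow, hτ, map_one]
  have hτσ' : s τ * s σ = s σ ^ 2 * s τ := by rw [← map_mul, hτσ, map_mul, map_pow]
  have hcl : Subgroup.closure ({s σ, s τ} : Set _) = (Subgroup.closure ({σ, τ} : Set (L ≃ₐ[F] L))).map s := by
    rw [MonoidHom.map_closure, Set.image_pair]
  -- the exact relation for `L_n / F`
  have MAIN := padicValNat_two_classNumber_symmetricThree F ↥(e.fieldRange ⊔ κ.layer n) (s σ) (s τ) hσ' hτ' hτσ'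
  rw [hcl, ← MonoidHom.map_zpowers, ← MonoidHom.map_zpowers] at MAIN
  -- class numbers of the fixed fields are those of the layers
  have conv : ∀ (H : Subgroup (L ≃ₐ[F] L))
      (hH : Function.Surjective (κ.toContinuousMonoidHom.comp (absGaloisRestrict F ↥(fixedField H)))),
      padicValNat 2 (NumberField.classNumber ↥(fixedField (H.map s))) = classNumberPExp (κ.restrict ↥(fixedField H) hH) n := by
    intro H hH
    rw [classNumberPExp_def, ← hcard H hH, NumberField.classNumber, Nat.card_eq_fintype_card]
  have convL : padicValNat 2 (NumberField.classNumber ↥(e.fieldRange ⊔ κ.layer n)) = classNumberPExp (κ.restrict L hL) n := by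
    rw [classNumberPExp_def, ← classNumber_eq_of_ringEquiv_aux eL, NumberField.classNumber,
      Nat.card_eq_fintype_card]
  rw [conv _ hk, conv _ hR, conv _ hK, convL] at MAIN
  exact MAIN

/-! ### §2 Iwasawa invariants -/

/-- **Growth form transfers to `L`, with the exact `λ`**: if the towers over `R = L^σ`, `K = L^τ` and `k = L^{σ,τ}` have `μ = 0`
(growth form), so does the tower over `L`, and **`λ(L) + 2λ(k) = λ(R) + 2λ(K)`**.
[cite: CaputoNuccio2020, Prop. 3.12] [cite: Washington1997, §13.3 Thm. 13.13] -/
theorem classicalLambda_symmetricThree_exact (κ : ZpExtension F 2) (L : Type) [Field L] [NumberField L] [Algebra F L]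
    [IsGalois F L] (hL : Function.Surjective (κ.toContinuousMonoidHom.comp (absGaloisRestrict F L)))
    {σ τ : L ≃ₐ[F] L} (hσ : σ ^ 3 = 1) (hτ : τ ^ 2 = 1) (hτσ : τ * σ = σ ^ 2 * τ)
    (hR : Function.Surjective (κ.toContinuousMonoidHom.comp (absGaloisRestrict F ↥(fixedField (Subgroup.zpowers σ)))))
    (hK : Function.Surjective (κ.toContinuousMonoidHom.comp (absGaloisRestrict F ↥(fixedField (Subgroup.zpowers τ)))))
    (hk : Function.Surjective (κ.toContinuousMonoidHom.comp
      (absGaloisRestrict F ↥(fixedField (Subgroup.closure ({σ, τ} : Set (L ≃ₐ[F] L)))))))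
    (hμR : ClassicalMuVanishes (κ.restrict ↥(fixedField (Subgroup.zpowers σ)) hR))
    (hμK : ClassicalMuVanishes (κ.restrict ↥(fixedField (Subgroup.zpowers τ)) hK))
    (hμk : ClassicalMuVanishes (κ.restrict ↥(fixedField (Subgroup.closure ({σ, τ} : Set (L ≃ₐ[F] L)))) hk)) :
    ClassicalMuVanishes (κ.restrict L hL) ∧
      classicalLambda (κ.restrict L hL) +
          2 * classicalLambda (κ.restrict ↥(fixedField (Subgroup.closure ({σ, τ} : Set (L ≃ₐ[F] L)))) hk) =
        classicalLambda (κ.restrict ↥(fixedField (Subgroup.zpowers σ)) hR) +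
          2 * classicalLambda (κ.restrict ↥(fixedField (Subgroup.zpowers τ)) hK) := by
  obtain ⟨νR, nR, hgR⟩ := classicalLambda_spec _ hμR
  obtain ⟨νK, nK, hgK⟩ := classicalLambda_spec _ hμK
  obtain ⟨νk, nk, hgk⟩ := classicalLambda_spec _ hμk
  set lR := classicalLambda (κ.restrict ↥(fixedField (Subgroup.zpowers σ)) hR)
  set lK := classicalLambda (κ.restrict ↥(fixedField (Subgroup.zpowers τ)) hK)
  set lk := classicalLambda (κ.restrict ↥(fixedField (Subgroup.closure ({σ, τ} : Set (L ≃ₐ[F] L)))) hk)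
  set N := max nR (max nK nk) with hN
  have hexact := fun n => classNumberPExp_symmetricThree_exact κ L hL hσ hτ hτσ hR hK hk n
  -- for `n ≥ N`: `e_n(L) = (lR + 2 lK) n + (νR + 2νK) − 2(lk n + νk)`
  have key : ∀ n, N ≤ n → (classNumberPExp (κ.restrict L hL) n : ℤ) + 2 * (lk * n + νk) =
      (lR * n + νR) + 2 * (lK * n + νK) := by
    intro n hn
    have h1 := hgR n (le_trans (le_max_left _ _) hn)
    have h2 := hgK n (le_trans ((le_max_left _ _).trans (le_max_right _ _)) hn)
    have h3 := hgk n (le_trans ((le_max_right _ _).trans (le_max_right _ _)) hn)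
    have h4 := hexact n
    rw [← h1, ← h2, ← h3]
    exact_mod_cast h4
  -- the slope of `L` is `lR + 2 lK − 2 lk`, a natural number
  have hslope : 2 * lk ≤ lR + 2 * lK := by
    -- compare `n = N` and `n = N + 1`: the difference of `e_n(L)` values is `lR + 2lK − 2lk ≥ … `; use nonnegativity at large `n`
    by_contra hlt'
    have hlt := not_le.mp hlt'
    -- `e_n(L) + 2(lk n + νk) = (lR+2lK) n + C`, so `e_n(L) = ((lR+2lK) − 2lk) n + C'` would be negative for large `n`
    have hC := key (N + (Int.toNat (νR + 2 * νK - 2 * νk) + 1)) (Nat.le_add_right _ _)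
    have hnn : (0 : ℤ) ≤ classNumberPExp (κ.restrict L hL) (N + (Int.toNat (νR + 2 * νK - 2 * νk) + 1)) := by positivity
    push_cast at hC
    have hlt' : (lR : ℤ) + 2 * lK + 1 ≤ 2 * lk := by exact_mod_cast hlt
    have ht : (νR + 2 * νK - 2 * νk : ℤ) ≤ (Int.toNat (νR + 2 * νK - 2 * νk) : ℤ) := Int.self_le_toNat _
    nlinarith
  refine ⟨⟨lR + 2 * lK - 2 * lk, νR + 2 * νK - 2 * νk, N, fun n hn => ?_⟩, ?_⟩
  · have h := key n hn
    push_cast [Nat.cast_sub hslope]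
    linarith
  · have hgrowth : ∀ n, N ≤ n → (classNumberPExp (κ.restrict L hL) n : ℤ) =
        ((lR + 2 * lK - 2 * lk : ℕ) : ℤ) * n + (νR + 2 * νK - 2 * νk) := by
      intro n hn
      have h := key n hn
      push_cast [Nat.cast_sub hslope]
      linarith
    have hl := eq_classicalLambda_of_growth (κ.restrict L hL) hgrowth
    omega

/-- **Growth form transfers to the resolvent**: `μ = 0` (growth form) for the towers over `L`, `K = L^τ`, `k = L^{σ,τ}` gives it
for `R = L^σ` (`e_n(R) = e_n(L) + 2e_n(k) − 2e_n(K)`). [cite: CaputoNuccio2020, Prop. 3.12] [cite: Washington1997, §13.3] -/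
theorem classicalMuVanishes_resolvent_of_three (κ : ZpExtension F 2) (L : Type) [Field L] [NumberField L] [Algebra F L]
    [IsGalois F L] (hL : Function.Surjective (κ.toContinuousMonoidHom.comp (absGaloisRestrict F L)))
    {σ τ : L ≃ₐ[F] L} (hσ : σ ^ 3 = 1) (hτ : τ ^ 2 = 1) (hτσ : τ * σ = σ ^ 2 * τ)
    (hR : Function.Surjective (κ.toContinuousMonoidHom.comp (absGaloisRestrict F ↥(fixedField (Subgroup.zpowers σ)))))
    (hK : Function.Surjective (κ.toContinuousMonoidHom.comp (absGaloisRestrict F ↥(fixedField (Subgroup.zpowers τ)))))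
    (hk : Function.Surjective (κ.toContinuousMonoidHom.comp
      (absGaloisRestrict F ↥(fixedField (Subgroup.closure ({σ, τ} : Set (L ≃ₐ[F] L)))))))
    (hμL : ClassicalMuVanishes (κ.restrict L hL))
    (hμK : ClassicalMuVanishes (κ.restrict ↥(fixedField (Subgroup.zpowers τ)) hK))
    (hμk : ClassicalMuVanishes (κ.restrict ↥(fixedField (Subgroup.closure ({σ, τ} : Set (L ≃ₐ[F] L)))) hk)) :
    ClassicalMuVanishes (κ.restrict ↥(fixedField (Subgroup.zpowers σ)) hR) := by
  obtain ⟨lL, νL, nL, hgL⟩ := hμL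
  obtain ⟨lK, νK, nK, hgK⟩ := hμK
  obtain ⟨lk, νk, nk, hgk⟩ := hμk
  set N := max nL (max nK nk) with hN
  have key : ∀ n, N ≤ n → (classNumberPExp (κ.restrict ↥(fixedField (Subgroup.zpowers σ)) hR) n : ℤ) + 2 * (lK * n + νK) =
      (lL * n + νL) + 2 * (lk * n + νk) := by
    intro n hn
    have h1 := hgL n (le_trans (le_max_left _ _) hn)
    have h2 := hgK n (le_trans ((le_max_left _ _).trans (le_max_right _ _)) hn)
    have h3 := hgk n (le_trans ((le_max_right _ _).trans (le_max_right _ _)) hn)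
    have h4 := classNumberPExp_symmetricThree_exact κ L hL hσ hτ hτσ hR hK hk n
    rw [← h1, ← h2, ← h3]
    linarith [(by exact_mod_cast h4 : (classNumberPExp (κ.restrict L hL) n : ℤ) +
      2 * classNumberPExp (κ.restrict ↥(fixedField (Subgroup.closure ({σ, τ} : Set (L ≃ₐ[F] L)))) hk) n =
      classNumberPExp (κ.restrict ↥(fixedField (Subgroup.zpowers σ)) hR) n +
      2 * classNumberPExp (κ.restrict ↥(fixedField (Subgroup.zpowers τ)) hK) n)]
  have hslope : 2 * lK ≤ lL + 2 * lk := by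
    by_contra hlt'
    have hlt := not_le.mp hlt'
    have hC := key (N + (Int.toNat (νL + 2 * νk - 2 * νK) + 1)) (Nat.le_add_right _ _)
    have hnn : (0 : ℤ) ≤ classNumberPExp (κ.restrict ↥(fixedField (Subgroup.zpowers σ)) hR)
      (N + (Int.toNat (νL + 2 * νk - 2 * νK) + 1)) := by positivity
    push_cast at hC
    have hlt' : (lL : ℤ) + 2 * lk + 1 ≤ 2 * lK := by exact_mod_cast hlt
    have ht : (νL + 2 * νk - 2 * νK : ℤ) ≤ (Int.toNat (νL + 2 * νk - 2 * νK) : ℤ) := Int.self_le_toNat _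
    nlinarith
  refine ⟨lL + 2 * lk - 2 * lK, νL + 2 * νk - 2 * νK, N, fun n hn => ?_⟩
  have h := key n hn
  push_cast [Nat.cast_sub hslope]
  linarith

/-! ### §3 The square closed: any three of `μ(L), μ(R), μ(K), μ(k) = 0` give the fourth (appended by att-p4 g31) -/

/-- **Halving a growth law.** If `2·e_n = a·n + b` for all `n ≥ N` (`a, b ∈ ℤ`), then `e_n = l·n + ν` eventually with `l ∈ ℕ`:
`a = 2(e_{N+1} − e_N)` and `b = 2e_N − aN` are even, and `a ≥ 0` because `e_n ≥ 0` for large `n`. The arithmetic step behind the two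
descents below (private arithmetic helper). [folklore] -/
private theorem classicalMuVanishes_of_two_mul_eq_linear {K' : Type} [Field K'] (κ' : ZpExtension K' 2) {a b : ℤ} {N : ℕ}
    (h : ∀ n, N ≤ n → 2 * (classNumberPExp κ' n : ℤ) = a * n + b) : ClassicalMuVanishes κ' := by
  have hN := h N le_rfl
  have hN1 := h (N + 1) (Nat.le_succ N)
  -- `a = 2 (e_{N+1} - e_N)`
  set l : ℤ := (classNumberPExp κ' (N + 1) : ℤ) - classNumberPExp κ' N with hl
  have ha : a = 2 * l := by push_cast at hN1; linarith
  -- `a ≥ 0`: otherwise `2 e_n` would be negative for large `n`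
  have hl0 : 0 ≤ l := by
    by_contra hlt'
    have hlt : l ≤ -1 := by omega
    have hC := h (N + (Int.toNat b + 1)) (Nat.le_add_right _ _)
    have hnn : (0 : ℤ) ≤ classNumberPExp κ' (N + (Int.toNat b + 1)) := by positivity
    have ht : b ≤ (Int.toNat b : ℤ) := Int.self_le_toNat _
    push_cast at hC
    nlinarith
  refine ⟨l.toNat, (classNumberPExp κ' N : ℤ) - l * N, N, fun n hn => ?_⟩
  have hn' := h n hn
  rw [Int.toNat_of_nonneg hl0]
  rw [ha] at hN hn'
  have : 2 * (classNumberPExp κ' n : ℤ) = 2 * (l * n + ((classNumberPExp κ' N : ℤ) - l * N)) := by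
    rw [hn']; linarith
  linarith

/-- **Descent to the "cubic" side `K = L^τ`**: `μ = 0` (growth form) for the towers over `L`, `R = L^σ` and `k = L^{σ,τ}` gives it for
`K = L^τ` — from the exact relation `2e_n(K) = e_n(L) + 2e_n(k) − e_n(R)` and the halving lemma — together with the exact `λ`:
`λ(L) + 2λ(k) = λ(R) + 2λ(K)`. (For `L/ℚ` an `S₃`-sextic: `μ₂(L) = 0 ⟹ μ₂` of the cubic subfield vanishes; the tree had this only through
odd-degree Galois descent of `2`-class groups.) [cite: CaputoNuccio2020, Prop. 3.12] [cite: Washington1997, §13.3 Thm. 13.13] -/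
theorem classicalMuVanishes_fixedField_tau_of_three (κ : ZpExtension F 2) (L : Type) [Field L] [NumberField L] [Algebra F L]
    [IsGalois F L] (hL : Function.Surjective (κ.toContinuousMonoidHom.comp (absGaloisRestrict F L)))
    {σ τ : L ≃ₐ[F] L} (hσ : σ ^ 3 = 1) (hτ : τ ^ 2 = 1) (hτσ : τ * σ = σ ^ 2 * τ)
    (hR : Function.Surjective (κ.toContinuousMonoidHom.comp (absGaloisRestrict F ↥(fixedField (Subgroup.zpowers σ)))))
    (hK : Function.Surjective (κ.toContinuousMonoidHom.comp (absGaloisRestrict F ↥(fixedField (Subgroup.zpowers τ)))))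
    (hk : Function.Surjective (κ.toContinuousMonoidHom.comp
      (absGaloisRestrict F ↥(fixedField (Subgroup.closure ({σ, τ} : Set (L ≃ₐ[F] L)))))))
    (hμL : ClassicalMuVanishes (κ.restrict L hL))
    (hμR : ClassicalMuVanishes (κ.restrict ↥(fixedField (Subgroup.zpowers σ)) hR))
    (hμk : ClassicalMuVanishes (κ.restrict ↥(fixedField (Subgroup.closure ({σ, τ} : Set (L ≃ₐ[F] L)))) hk)) :
    ClassicalMuVanishes (κ.restrict ↥(fixedField (Subgroup.zpowers τ)) hK) ∧
      classicalLambda (κ.restrict L hL) +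
          2 * classicalLambda (κ.restrict ↥(fixedField (Subgroup.closure ({σ, τ} : Set (L ≃ₐ[F] L)))) hk) =
        classicalLambda (κ.restrict ↥(fixedField (Subgroup.zpowers σ)) hR) +
          2 * classicalLambda (κ.restrict ↥(fixedField (Subgroup.zpowers τ)) hK) := by
  obtain ⟨lL, νL, nL, hgL⟩ := hμL
  obtain ⟨lR, νR, nR, hgR⟩ := hμR
  obtain ⟨lk, νk, nk, hgk⟩ := hμk
  set N := max nL (max nR nk) with hN
  have hμK : ClassicalMuVanishes (κ.restrict ↥(fixedField (Subgroup.zpowers τ)) hK) := by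
    refine classicalMuVanishes_of_two_mul_eq_linear _ (a := lL + 2 * lk - lR) (b := νL + 2 * νk - νR) (N := N) fun n hn => ?_
    have h1 := hgL n (le_trans (le_max_left _ _) hn)
    have h2 := hgR n (le_trans ((le_max_left _ _).trans (le_max_right _ _)) hn)
    have h3 := hgk n (le_trans ((le_max_right _ _).trans (le_max_right _ _)) hn)
    have h4 := classNumberPExp_symmetricThree_exact κ L hL hσ hτ hτσ hR hK hk n
    have h4' : (classNumberPExp (κ.restrict L hL) n : ℤ) +
        2 * classNumberPExp (κ.restrict ↥(fixedField (Subgroup.closure ({σ, τ} : Set (L ≃ₐ[F] L)))) hk) n =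
        classNumberPExp (κ.restrict ↥(fixedField (Subgroup.zpowers σ)) hR) n +
        2 * classNumberPExp (κ.restrict ↥(fixedField (Subgroup.zpowers τ)) hK) n := by exact_mod_cast h4
    rw [h1, h2, h3] at h4'
    linarith
  exact ⟨hμK, (classicalLambda_symmetricThree_exact κ L hL hσ hτ hτσ hR hK hk ⟨lR, νR, nR, hgR⟩ hμK ⟨lk, νk, nk, hgk⟩).2⟩

/-- **Descent to the base `k = L^{σ,τ}`**: `μ = 0` (growth form) for the towers over `L`, `R = L^σ`, `K = L^τ` gives it for `k`
(`2e_n(k) = e_n(R) + 2e_n(K) − e_n(L)`, halving lemma), with the exact `λ`. [cite: CaputoNuccio2020, Prop. 3.12] [cite: Washington1997, §13.3 Thm. 13.13] -/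
theorem classicalMuVanishes_fixedField_closure_of_three (κ : ZpExtension F 2) (L : Type) [Field L] [NumberField L] [Algebra F L]
    [IsGalois F L] (hL : Function.Surjective (κ.toContinuousMonoidHom.comp (absGaloisRestrict F L)))
    {σ τ : L ≃ₐ[F] L} (hσ : σ ^ 3 = 1) (hτ : τ ^ 2 = 1) (hτσ : τ * σ = σ ^ 2 * τ)
    (hR : Function.Surjective (κ.toContinuousMonoidHom.comp (absGaloisRestrict F ↥(fixedField (Subgroup.zpowers σ)))))
    (hK : Function.Surjective (κ.toContinuousMonoidHom.comp (absGaloisRestrict F ↥(fixedField (Subgroup.zpowers τ)))))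
    (hk : Function.Surjective (κ.toContinuousMonoidHom.comp
      (absGaloisRestrict F ↥(fixedField (Subgroup.closure ({σ, τ} : Set (L ≃ₐ[F] L)))))))
    (hμL : ClassicalMuVanishes (κ.restrict L hL))
    (hμR : ClassicalMuVanishes (κ.restrict ↥(fixedField (Subgroup.zpowers σ)) hR))
    (hμK : ClassicalMuVanishes (κ.restrict ↥(fixedField (Subgroup.zpowers τ)) hK)) :
    ClassicalMuVanishes (κ.restrict ↥(fixedField (Subgroup.closure ({σ, τ} : Set (L ≃ₐ[F] L)))) hk) ∧
      classicalLambda (κ.restrict L hL) +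
          2 * classicalLambda (κ.restrict ↥(fixedField (Subgroup.closure ({σ, τ} : Set (L ≃ₐ[F] L)))) hk) =
        classicalLambda (κ.restrict ↥(fixedField (Subgroup.zpowers σ)) hR) +
          2 * classicalLambda (κ.restrict ↥(fixedField (Subgroup.zpowers τ)) hK) := by
  obtain ⟨lL, νL, nL, hgL⟩ := hμL
  obtain ⟨lR, νR, nR, hgR⟩ := hμR
  obtain ⟨lK, νK, nK, hgK⟩ := hμK
  set N := max nL (max nR nK) with hN
  have hμk : ClassicalMuVanishes (κ.restrict ↥(fixedField (Subgroup.closure ({σ, τ} : Set (L ≃ₐ[F] L)))) hk) := by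
    refine classicalMuVanishes_of_two_mul_eq_linear _ (a := lR + 2 * lK - lL) (b := νR + 2 * νK - νL) (N := N) fun n hn => ?_
    have h1 := hgL n (le_trans (le_max_left _ _) hn)
    have h2 := hgR n (le_trans ((le_max_left _ _).trans (le_max_right _ _)) hn)
    have h3 := hgK n (le_trans ((le_max_right _ _).trans (le_max_right _ _)) hn)
    have h4 := classNumberPExp_symmetricThree_exact κ L hL hσ hτ hτσ hR hK hk n
    have h4' : (classNumberPExp (κ.restrict L hL) n : ℤ) +
        2 * classNumberPExp (κ.restrict ↥(fixedField (Subgroup.closure ({σ, τ} : Set (L ≃ₐ[F] L)))) hk) n =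
        classNumberPExp (κ.restrict ↥(fixedField (Subgroup.zpowers σ)) hR) n +
        2 * classNumberPExp (κ.restrict ↥(fixedField (Subgroup.zpowers τ)) hK) n := by exact_mod_cast h4
    rw [h1, h2, h3] at h4'
    linarith
  exact ⟨hμk, (classicalLambda_symmetricThree_exact κ L hL hσ hτ hτσ hR hK hk ⟨lR, νR, nR, hgR⟩ ⟨lK, νK, nK, hgK⟩ hμk).2⟩

/-- **The square, as an `iff` on the two `S₃`-specific towers**: when the towers over the resolvent `R = L^σ` and over the base `k = L^{σ,τ}`
have `μ = 0` (e.g. `F = k = ℚ` and `R` quadratic: Weber, and Ferrero–Washington / the tree's quadratic theorems), then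
**`μ(L) = 0 ⟺ μ(K) = 0`** for `K = L^τ` (growth form): `S₃`-field and "cubic" subfield have `μ₂ = 0` together.
[cite: CaputoNuccio2020, Prop. 3.12] [cite: Washington1997, §13.3 Thm. 13.13] -/
theorem classicalMuVanishes_iff_fixedField_tau_of_resolvent_of_base (κ : ZpExtension F 2) (L : Type) [Field L] [NumberField L]
    [Algebra F L] [IsGalois F L] (hL : Function.Surjective (κ.toContinuousMonoidHom.comp (absGaloisRestrict F L)))
    {σ τ : L ≃ₐ[F] L} (hσ : σ ^ 3 = 1) (hτ : τ ^ 2 = 1) (hτσ : τ * σ = σ ^ 2 * τ)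
    (hR : Function.Surjective (κ.toContinuousMonoidHom.comp (absGaloisRestrict F ↥(fixedField (Subgroup.zpowers σ)))))
    (hK : Function.Surjective (κ.toContinuousMonoidHom.comp (absGaloisRestrict F ↥(fixedField (Subgroup.zpowers τ)))))
    (hk : Function.Surjective (κ.toContinuousMonoidHom.comp
      (absGaloisRestrict F ↥(fixedField (Subgroup.closure ({σ, τ} : Set (L ≃ₐ[F] L)))))))
    (hμR : ClassicalMuVanishes (κ.restrict ↥(fixedField (Subgroup.zpowers σ)) hR))
    (hμk : ClassicalMuVanishes (κ.restrict ↥(fixedField (Subgroup.closure ({σ, τ} : Set (L ≃ₐ[F] L)))) hk)) :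
    ClassicalMuVanishes (κ.restrict L hL) ↔ ClassicalMuVanishes (κ.restrict ↥(fixedField (Subgroup.zpowers τ)) hK) :=
  ⟨fun hμL => (classicalMuVanishes_fixedField_tau_of_three κ L hL hσ hτ hτσ hR hK hk hμL hμR hμk).1,
    fun hμK => (classicalLambda_symmetricThree_exact κ L hL hσ hτ hτσ hR hK hk hμR hμK hμk).1⟩

end Literature.NumberTheory.IwasawaTheory
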